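import Literature.Analysis.FluidPDE.BoundedMildAncientPressureLogGrowth
import HarnessLib

/-!
# The pressure of a BOUNDED mild ancient solution is SUBLINEAR AT INFINITY (inertial gauge)

Analysis/FluidPDE proof file (all results proved, standard axioms), companion of `BoundedMildAncientPressureLogGrowth.lean`: the logarithmic
growth `|P(t,x) − P(t,0)| ≤ K (1 + log (1 + ‖x‖))` of every classical pressure of a bounded KNSS-mild ancient solution (Seregin 2014,
Def. 6.3 / Lemma 6.5) implies, by `log (1 + r) = o(r)`, that every slice pressure is SUBLINEAR AT INFINITY:
`∀ ε > 0, ∃ R, ∀ y, R ≤ ‖y‖ → |P(t,y)| ≤ ε ‖y‖` — the body of the W1 custodians' predicate `IsSublinearAtInfinity (P t)`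
(`Summits/NavierStokesRegularity/…/Cruxes/PoloidalLiouville/HorizonTowerSketch.lean` v5, gauge binder of the scope gap C′
`ScaleFreeFarFieldSublinear`), so the binder is AUTOMATIC for the inertial (KNSS-mild) members of the bounded ancient class; the accelerated
rest frames (linear pressures) are exactly the non-mild members and violate it.

* `sublinear_of_log_growth` — the `o(r)` bookkeeping (`Real.isLittleO_log_id_atTop`);
* `pressure_sublinear_of_bounded_oseenMild` — the corollary, hypotheses = those of `BoundedMildAncientPressureLogGrowth` binder for binder.

## References

* G. Seregin, *Lecture Notes on Regularity Theory for the Navier–Stokes Equations*, World Scientific 2014, §6.2 Lemma 6.5, §6.3 Def. 6.3,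
  Remark 6.4. [Seregin2014]

WHAT THIS IS NOT: not a claim about NS regularity or the Liouville conjecture; nothing is said about non-mild (drifting) bounded ancient
solutions, for which the conclusion is false.
-/

noncomputable section

open Set Function
open _root_.Topology

namespace Literature.Analysis.FluidPDE

section BoundedMildPressureSublinear

open Filter

/-- `log (1 + r) = o(r)` bookkeeping: a function on `ℝ³` bounded by `c₀ + K (1 + log (1 + ‖x‖))` is sublinear at infinity,
`∀ ε > 0, ∃ R, ∀ y, R ≤ ‖y‖ → |q y| ≤ ε ‖y‖`. [cite: Seregin2014, §6.2 Lemma 6.5 (BMO ⇒ logarithmic, hence sublinear, growth)] -/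
theorem sublinear_of_log_growth {q : EuclideanSpace ℝ (Fin 3) → ℝ} {c₀ K : ℝ}
    (h : ∀ x, |q x| ≤ c₀ + K * (1 + Real.log (1 + ‖x‖))) :
    ∀ ε : ℝ, 0 < ε → ∃ R : ℝ, ∀ y : EuclideanSpace ℝ (Fin 3), R ≤ ‖y‖ → |q y| ≤ ε * ‖y‖ := by
  intro ε hε
  -- a nonnegative constant `K' ≥ K`, `K' ≥ 1`
  set K' : ℝ := max K 1 with hK'
  have hK'1 : 1 ≤ K' := le_max_right _ _
  have hK'0 : 0 < K' := by linarith
  have hKK : K ≤ K' := le_max_left _ _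
  have h' : ∀ x, |q x| ≤ |c₀| + K' * (1 + Real.log (1 + ‖x‖)) := by
    intro x
    have hL0 : 0 ≤ 1 + Real.log (1 + ‖x‖) := by
      have := Real.log_nonneg (by linarith [norm_nonneg x] : (1 : ℝ) ≤ 1 + ‖x‖); linarith
    calc |q x| ≤ c₀ + K * (1 + Real.log (1 + ‖x‖)) := h x
      _ ≤ |c₀| + K' * (1 + Real.log (1 + ‖x‖)) := add_le_add (le_abs_self _) (mul_le_mul_of_nonneg_right hKK hL0)
  -- `log x ≤ c x` for large `x`, with `K' c = ε / 2`
  set c : ℝ := ε / (2 * K') with hc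
  have hc0 : 0 < c := by rw [hc]; positivity
  have hlog := (Real.isLittleO_log_id_atTop.def hc0)
  obtain ⟨R₀, hR₀⟩ := Filter.eventually_atTop.1 hlog
  -- the radius
  set D : ℝ := |c₀| + K' + K' * c with hD
  have hD0 : 0 ≤ D := by rw [hD]; positivity
  refine ⟨max R₀ (2 * D / ε), fun y hy => ?_⟩
  have hyR₀ : R₀ ≤ ‖y‖ := (le_max_left _ _).trans hy
  have hyD : 2 * D / ε ≤ ‖y‖ := (le_max_right _ _).trans hy
  have h1y : R₀ ≤ 1 + ‖y‖ := by linarith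
  have hlog1 : Real.log (1 + ‖y‖) ≤ c * (1 + ‖y‖) := by
    have h := hR₀ (1 + ‖y‖) h1y
    have hpos : 0 ≤ 1 + ‖y‖ := by linarith [norm_nonneg y]
    rw [id, Real.norm_eq_abs, Real.norm_eq_abs, abs_of_nonneg (Real.log_nonneg (by linarith [norm_nonneg y])),
      abs_of_nonneg hpos] at h
    exact h
  have hDy : D ≤ ε / 2 * ‖y‖ := by
    have h := (div_le_iff₀ hε).1 hyD
    linarith
  have hKc : K' * c = ε / 2 := by rw [hc]; field_simp
  calc |q y| ≤ |c₀| + K' * (1 + Real.log (1 + ‖y‖)) := h' y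
    _ ≤ |c₀| + K' * (1 + c * (1 + ‖y‖)) := by
        have := mul_le_mul_of_nonneg_left (add_le_add_left hlog1 1) hK'0.le; linarith
    _ = D + (K' * c) * ‖y‖ := by rw [hD]; ring
    _ ≤ ε / 2 * ‖y‖ + ε / 2 * ‖y‖ := by rw [hKc]; linarith
    _ = ε * ‖y‖ := by ring

/-- **The pressure of a BOUNDED mild ancient solution is SUBLINEAR AT INFINITY on every slice** — the inertial-gauge property of the W1
custodians' predicate `IsSublinearAtInfinity (P t)` (body unfolded: `∀ ε > 0, ∃ R, ∀ y, R ≤ ‖y‖ → |P t y| ≤ ε ‖y‖`): automatic for every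
classical pressure of a bounded, continuous, Oseen-mild, divergence-free ancient profile (the parasitic drifting frames, whose pressures are
linear, are not mild).  [cite: Seregin2014, §6.3 Def. 6.3 + Remark 6.4 (p. 103, 109); §6.2 Lemma 6.5] -/
theorem pressure_sublinear_of_bounded_oseenMild (M : ℝ)
    (v : ℝ → EuclideanSpace ℝ (Fin 3) → EuclideanSpace ℝ (Fin 3)) (P : ℝ → EuclideanSpace ℝ (Fin 3) → ℝ)
    (hbd : ∀ t < 0, ∀ x, ‖v t x‖ ≤ M)
    (hcont : ContinuousOn (Function.uncurry v) (Set.Iio (0 : ℝ) ×ˢ Set.univ))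
    (hmild : ∀ s t : ℝ, s < t → t < 0 → ∀ x, v t x =
      UnboundedOperators.heatExtension (v s) (t - s) x - oseenDuhamel 1 s v v t x)
    (hdiv : ∀ t < 0, VectorCalculus.IsDivFree (v t))
    (hcl : IsClassicalNSSolutionOn (Set.Iio 0) 1 0 v P) :
    ∀ t < 0, ∀ ε : ℝ, 0 < ε → ∃ R : ℝ, ∀ y : EuclideanSpace ℝ (Fin 3), R ≤ ‖y‖ → |P t y| ≤ ε * ‖y‖ := by
  intro t ht
  obtain ⟨K, hK⟩ := exists_abs_pressure_sub_le_log_of_bounded_oseenMild M v P hbd hcont hmild hdiv hcl t ht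
  refine sublinear_of_log_growth (c₀ := |P t 0|) (K := K) fun x => ?_
  have h := hK x
  have h2 : |P t x| ≤ |P t x - P t 0| + |P t 0| := by
    have := abs_add_le (P t x - P t 0) (P t 0); rwa [sub_add_cancel] at this
  linarith

end BoundedMildPressureSublinear

end Literature.Analysis.FluidPDE

end
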